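import Summits.ResolutionOfSingularities.ResolutionOfSingularities.Theorems.WeightedInvariantWeightedConstructionLexmaxHullDefs
import Summits.ResolutionOfSingularities.ResolutionOfSingularities.Theorems.WeightedInvariantWeightedConstructionHullUscGenericValue

/-!
# Crux `WeightedConstruction`, line `pointwise-lexmax-hull`: stub `stub_hullUsc` from its three `plex`-level parts

Route `ResolutionOfSingularities/WeightedInvariant`, crux `WeightedConstruction`
(stmt-ResolutionOfSingularities-0571), line `pointwise-lexmax-hull`. [OURS · L1 W4.3] Plan of record
(CHAIN w43 v0.5, plan-1 ruling 2026-08-26T18:35:57Z): the registered stub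

  `stub_hullUsc : ∀ p, p.Prime → ∀ R : LexmaxHullRule p, R.USC ∧ R.HullComap ∧ R.HullBaseChange`

is SPLIT into `stub_plexStrata` (B1′: `R.PlexStrata`), `stub_plexComap` (B2′: `R.PlexComap`),
`stub_plexBaseChange` (B3′: `R.PlexBaseChange`) — properties of the pointwise invariant `plex` at CLOSED
singular points, defined in `Theorems/…LexmaxHullDefs.lean` — and becomes the sorry-free theorem
`stub_hullUsc_of_plex` below. The proofs instantiate the landed generic reductions
(`Theorems/…HullUscToolkit.lean` p459633: hull ⇝ gen; `Theorems/…HullUscGenericValue.lean` p460524: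
gen ⇝ plex) at `S := XSing X`, `gen := R.gen f X`, `hull := R.hull f X`, using of the rule ONLY the fields
`gen_spec` and `hull_isGreatest`:

* `LexmaxHullRule.usc_of_plexStrata`             — (B1′) ⇒ `R.USC`;
* `LexmaxHullRule.hullComap_of_plexComap`         — (B2′) ⇒ `R.HullComap`;
* `LexmaxHullRule.hullBaseChange_of_plexBaseChange` — (B3′) ⇒ `R.HullBaseChange` (the base-changed
  structure morphism inherits smooth / separated / quasi-compact, `K` inherits characteristic `p` via `φ`);
* `stub_hullUsc_of_plex` — the registered signature of `stub_hullUsc` from the three parts.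

NOT a statement of the manuscript under review; no new mathematics.
-/

noncomputable section

open CategoryTheory CategoryTheory.Limits AlgebraicGeometry TopologicalSpace
open Literature.AlgebraicGeometry.Resolution
open Summit.ResolutionOfSingularities.ResolutionOfSingularities.Theses.WeightedInvariant

set_option linter.dupNamespace false -- mandated namespace of this single-conjunct summit

namespace Summit.ResolutionOfSingularities.ResolutionOfSingularities.Theorems.PointwiseLexmaxHull

namespace LexmaxHullRule

variable {p : ℕ} (R : LexmaxHullRule p)

/-- **(B1′) ⇒ `(usc)`**: a finite `plex`-constant stratification of the singular locus makes every
superlevel set of the hull closed (`isClosed_superlevel_genHull_xSing_of_plexStrata` with the rule's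
`gen_spec`, `hull_isGreatest`). [folklore] -/
theorem usc_of_plexStrata (h : R.PlexStrata) : R.USC := by
  intro k _ _ _ Y f _ _ _ X γ
  obtain ⟨F, W, hfin, hFS, hcover, hval⟩ := h f X
  exact isClosed_superlevel_genHull_xSing_of_plexStrata f X (R.gen_spec f X) (R.hull_isGreatest f X)
    hfin hFS W hcover hval γ

/-- **(B2′) ⇒ `(i)` for smooth morphisms**: pointwise invariance of `plex` at closed singular points under
a smooth `k`-morphism gives invariance of the hull at all singular points
(`genHull_comap_eq_of_smooth_of_plex`). [folklore] -/
theorem hullComap_of_plexComap (h : R.PlexComap) : R.HullComap := by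
  intro k _ _ _ Y Y₁ f _ _ _ f₁ _ _ _ g _ hg X y₁ hy
  exact genHull_comap_eq_of_smooth_of_plex f f₁ g hg X (R.gen_spec f X) (R.gen_spec f₁ (X.comap g))
    (R.hull_isGreatest f X) (R.hull_isGreatest f₁ (X.comap g))
    (fun y₁ hcl hS => h f f₁ g hg X y₁ hcl hS) y₁ hy

/-- **(B3′) ⇒ `(i)` for perfect ground-field extensions**: in the cartesian square over `φ : k → K` the
base-changed structure morphism `fK` is smooth, separated and quasi-compact (base change) and `K` has
characteristic `p` (through `φ`), so the rule's `gen_spec`/`hull_isGreatest` apply upstairs, and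
`genHull_comap_eq_of_isPullback_of_plex` concludes. [folklore] -/
theorem hullBaseChange_of_plexBaseChange (h : R.PlexBaseChange) : R.HullBaseChange := by
  intro k _ _ _ K _ _ φ Y YK f _ _ _ fK pr hpb X y hy
  haveI : CharP K p := (RingHom.charP_iff_charP φ p).mp inferInstance
  haveI : Smooth fK :=
    MorphismProperty.IsStableUnderBaseChange.of_isPullback (P := @Smooth) hpb ‹Smooth f›
  haveI : IsSeparated fK :=
    MorphismProperty.IsStableUnderBaseChange.of_isPullback (P := @IsSeparated) hpb ‹IsSeparated f›
  haveI : QuasiCompact fK :=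
    MorphismProperty.IsStableUnderBaseChange.of_isPullback (P := @QuasiCompact) hpb ‹QuasiCompact f›
  exact genHull_comap_eq_of_isPullback_of_plex φ f fK pr hpb X (R.gen_spec f X)
    (R.gen_spec fK (X.comap pr)) (R.hull_isGreatest f X) (R.hull_isGreatest fK (X.comap pr))
    (fun y₁ hcl hS => h φ f fK pr hpb X y₁ hcl hS) y hy

end LexmaxHullRule

/-- **`stub_hullUsc` from its three `plex`-level parts** (plan of record: stub B = B1′ ∧ B2′ ∧ B3′): for
every prime `p` and every rule `R`, `R.PlexStrata`, `R.PlexComap`, `R.PlexBaseChange` give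
`R.USC ∧ R.HullComap ∧ R.HullBaseChange` — the registered signature of `stub_hullUsc`. [folklore] -/
theorem stub_hullUsc_of_plex
    (hA : ∀ p : ℕ, p.Prime → ∀ R : LexmaxHullRule p, R.PlexStrata)
    (hB : ∀ p : ℕ, p.Prime → ∀ R : LexmaxHullRule p, R.PlexComap)
    (hC : ∀ p : ℕ, p.Prime → ∀ R : LexmaxHullRule p, R.PlexBaseChange) :
    ∀ p : ℕ, p.Prime → ∀ R : LexmaxHullRule p, R.USC ∧ R.HullComap ∧ R.HullBaseChange :=
  fun p hp R => ⟨R.usc_of_plexStrata (hA p hp R), R.hullComap_of_plexComap (hB p hp R),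
    R.hullBaseChange_of_plexBaseChange (hC p hp R)⟩

end Summit.ResolutionOfSingularities.ResolutionOfSingularities.Theorems.PointwiseLexmaxHull

end
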